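import Literature.Probability.RandomPlanarGeometry.HexSAWEndpointEnvelope
import Literature.Probability.RandomPlanarGeometry.HexSAWBrickWallPolygonPairs
import HarnessLib

/-!
# The polygon two-step ratio on the honeycomb lattice, unconditional: `p_{n+2}(ℍ)/p_n(ℍ) → μ_ℍ² = 2 + √2`
# (Madras–Slade Theorem 7.3.4 (c) on `ℍ`; «HEX-ENDPOINT-RATIO-2», file F5 = the composition with the lane's HEX-SAP line)

Topic `Literature/Probability/RandomPlanarGeometry` (lane «pcv-sawmu»; composes `HexSAWEndpointEnvelope.lean` — the schema
`HV.HexSAPPairBound P` and `hexAdjEndRatioTwo_of_pairBound` / `hexPolygonRatioTwo_of_pairBound` / `hexAdjEndLo_of_pairBound`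
(a-p4 g7) — with `HexSAWBrickWallPolygonPairs.lean` — Madras–Slade Theorem 3.2.4 on `ℍ`, both residues:
`HexBW.sq_bridgeCount_le_mul_endAtCount (hK : 1 ≤ K) : b_{2K}(ℍ)² ≤ 4(4K+13)⁴(2K+7)² · endAtCount (4K+21) e₀ ∧ (same at 4K+23)`
(a-p6 g6). The restatement in a-p6's polygon-count normalisation `hexPolygonCount` (`HexSAWBrickWallPolygonGrowth.lean`) is the
sequel `HexSAWPolygonCountRatio.lean`.)

Source: N. Madras, G. Slade, *The Self-Avoiding Walk* (1993), Theorem 7.3.4 (c) p. 248: "`lim_{N→∞} q_{2N+2}/q_{2N} = μ²`"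
("a direct consequence of part (b) and the basic relation (3.2.1)"); H. Kesten, J. Math. Phys. 4 (1963) §4; H. Duminil-Copin,
S. Smirnov, Ann. Math. 175 (2012) Theorem 1 (`μ_ℍ = √(2+√2)`). Printed and proved for `ℤ^d` only; for `ℍ` nothing is printed
for polygon-count ratios (lane lit-1 cell 2026-08-22T23:54:47Z; Jensen's honeycomb-polygon series estimate `x_c² = 0.2928932…`
numerically). THIS FILE: the lane's two frozen interfaces compose with no adapter — a-p6's FACE 1 IS an instance of the schema
`HexSAPPairBound` (the spellings `endAtCount n z` / `#((HexBW.saws n).filter (· n = z))` agree definitionally), its polynomial has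
degree 6 (`4(4K+13)⁴(2K+7)² ≤ 27 060 804 · K⁶`), and F4 turns the pair bound into the polygon envelope and the ratio limit.
(The composition was first checked in HOME by the lane's custodian a-idea-2 g13, `Compose_HEXSAP_F4_check.lean` b8764c592adcef4e;
this is its tree edition, same three lines.) Label (lane): «M–S Thm 7.3.4 (c) (Kesten 1963) on `ℍ` with the explicit limit
`2+√2`; first text for `ℍ`; consolidation-grade».

## Contents (namespace `Literature.Probability.RandomPlanarGeometry.SAW.HV`; all PROVED, NO hypotheses, axioms standard)

* `pairBound_of_hexsap : HexSAPPairBound (fun K => 4 * (4 * K + 13) ^ 4 * (2 * K + 7) ^ 2)` (a-p6's FACE 1 by `exact`);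
* `hexsapPoly_le (hK : 1 ≤ K) : 4(4K+13)⁴(2K+7)² ≤ 27060804 · K⁶`;
* **`hexAdjEndLo : HexAdjEndLo (Real.log 27060804 + 2·6 + 30)`** — the polygon lower envelope `e^{-c√n} μ_ℍ^n ≤ #A_n`, odd `n` large;
* **`hexPolygonRatioTwo (hz : hvGraph.Adj hvOrigin z)`** — `#E_{2m+3}(z)/#E_{2m+1}(z) → 2 + √2` for each neighbour `z` of the origin;
* **`hexAdjEndRatioTwo`** — `#A_{2m+3}/#A_{2m+1} → 2 + √2` (walks ending next to the origin);
-/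

noncomputable section

open Finset Filter Topology Literature.Probability.LatticeModels SimpleGraph

namespace Literature.Probability.RandomPlanarGeometry.SAW.HV

/-- **a-p6's HEX-SAP FACE 1 is an instance of the schema `HexSAPPairBound`** (Madras–Slade Theorem 3.2.4 on `ℍ`, both residues,
`P(K) = 4(4K+13)⁴(2K+7)²`). [cite: MadrasSlade1993, Theorem 3.2.4 (p. 65–66)] -/
theorem pairBound_of_hexsap : HexSAPPairBound (fun K => 4 * (4 * K + 13) ^ 4 * (2 * K + 7) ^ 2) :=
  fun _ hK => HexBW.sq_bridgeCount_le_mul_endAtCount hK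

/-- Degree bound: `4(4K+13)⁴(2K+7)² ≤ 27 060 804 · K⁶` for `K ≥ 1` (`4·17⁴·9² = 27060804`). [cite: MadrasSlade1993, Theorem 3.2.4 (p. 65–66) (the polynomial factor)] -/
theorem hexsapPoly_le (K : ℕ) (hK : 1 ≤ K) :
    ((4 * (4 * K + 13) ^ 4 * (2 * K + 7) ^ 2 : ℕ) : ℝ) ≤ 27060804 * (K : ℝ) ^ 6 := by
  have h1 : 4 * K + 13 ≤ 17 * K := by omega
  have h2 : 2 * K + 7 ≤ 9 * K := by omega
  have h : 4 * (4 * K + 13) ^ 4 * (2 * K + 7) ^ 2 ≤ 4 * (17 * K) ^ 4 * (9 * K) ^ 2 :=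
    Nat.mul_le_mul (Nat.mul_le_mul_left _ (Nat.pow_le_pow_left h1 4)) (Nat.pow_le_pow_left h2 2)
  have h' : ((4 * (17 * K) ^ 4 * (9 * K) ^ 2 : ℕ) : ℝ) = 27060804 * (K : ℝ) ^ 6 := by push_cast; ring
  calc ((4 * (4 * K + 13) ^ 4 * (2 * K + 7) ^ 2 : ℕ) : ℝ) ≤ ((4 * (17 * K) ^ 4 * (9 * K) ^ 2 : ℕ) : ℝ) := by
        exact_mod_cast h
    _ = 27060804 * (K : ℝ) ^ 6 := h'

/-- **The polygon lower envelope on `ℍ`, unconditional**: `e^{−(log 27060804 + 42)√n} μ_ℍ^n ≤ #A_n` for all large odd `n` — the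
honeycomb analogue of Madras–Slade (3.2.5)/Corollary 3.2.6 for walks ending next to the origin.
[cite: MadrasSlade1993, Theorem 3.2.3 (3.2.5) p. 65 and Corollary 3.2.6 p. 68] -/
theorem hexAdjEndLo : HexAdjEndLo (Real.log 27060804 + 2 * (6 : ℕ) + 30) :=
  hexAdjEndLo_of_pairBound (d := 27060804) (k := 6) (by norm_num) hexsapPoly_le pairBound_of_hexsap

/-- **Theorem 7.3.4 (c) on `ℍ`, per neighbour, NO hypotheses**: for each neighbour `z` of the origin,
`#E_{2m+3}(z)/#E_{2m+1}(z) → 2 + √2` (rooted `(2m+4)`-gons over rooted `(2m+2)`-gons through the edge `{0,z}`).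
[cite: MadrasSlade1993, Theorem 7.3.4 (b)(c) (p. 248) and its proof (Lemma 7.3.1 p. 242, Cor 3.2.6 p. 68, Thm 7.3.2 (c) p. 244, Lemma 7.3.3 p. 247, (3.2.1) p. 63)]
[cite: Kesten1963SAW, §4] [cite: DuminilCopinSmirnov2012, Theorem 1] -/
theorem hexPolygonRatioTwo {z : HV} (hz : hvGraph.Adj hvOrigin z) :
    Tendsto (fun m : ℕ => (#(endFin z (2 * m + 1 + 2)) : ℝ) / #(endFin z (2 * m + 1))) atTop (𝓝 (2 + Real.sqrt 2)) :=
  hexPolygonRatioTwo_of_pairBound (d := 27060804) (k := 6) (by norm_num) hexsapPoly_le pairBound_of_hexsap hz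

/-- **Theorem 7.3.4 (c) on `ℍ`, NO hypotheses**: `#A_{2m+3}/#A_{2m+1} → 2 + √2` — self-avoiding walks from the origin ending NEXT
TO the origin (≡ rooted polygons through the origin, M–S (3.2.1)), lengths `2m+3` over `2m+1`.
[cite: MadrasSlade1993, Theorem 7.3.4 (b)(c) (p. 248) and its proof (Lemma 7.3.1 p. 242, Cor 3.2.6 p. 68, Thm 7.3.2 (c) p. 244, Lemma 7.3.3 p. 247, (3.2.1) p. 63)]
[cite: Kesten1963SAW, §4] [cite: DuminilCopinSmirnov2012, Theorem 1] -/
theorem hexAdjEndRatioTwo :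
    Tendsto (fun m : ℕ => (#(adjEndFin (2 * m + 1 + 2)) : ℝ) / #(adjEndFin (2 * m + 1))) atTop (𝓝 (2 + Real.sqrt 2)) :=
  hexAdjEndRatioTwo_of_pairBound (d := 27060804) (k := 6) (by norm_num) hexsapPoly_le pairBound_of_hexsap

end Literature.Probability.RandomPlanarGeometry.SAW.HV

end
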